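import Summits.Ventures.Crystal3D.Theorems.StickyWulffConstantCoaxialWallLawHalfPlanarKey
import Literature.Algebra.EuclideanLattices.FccBccLattices
import Mathlib.Analysis.SpecialFunctions.Complex.Arg
import HarnessLib

/-!
# The planar-heights kissing row at offset `½`, brick 2: the frame `(e, m × e, m)`, azimuths, the pair lemma

HONEST FRAMING. Part of the venture `Summits/Ventures/Crystal3D` (cell `crystal3d-full`), helper
`--supports` the crux `CoaxialWallLaw` (stmt-Ventures-19481, `route-Ventures-StickyWulffConstant`),
REGISTERED line `WallLedgerF`, open stub `stub_coaxialTwoSlabAdhesion`.  RUNG CREDIT ONLY; F-C1 not moved.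

For a unit axis `m` and an in-plane unit vector `e`: the second frame coordinate `hpY m e v = det(m, e, v)`,
PARSEVAL `⟪u,v⟫ = ⟪u,e⟫⟪v,e⟫ + Y_u Y_v + ⟪u,m⟫⟪v,m⟫` (`hp_parseval`, a polynomial identity), the AZIMUTH
`hpAz m e v ∈ [0, 2π)` of the horizontal part (`Complex.arg`), its polar form, `hpAz m e e = 0`, and the
**PAIR LEMMA** `hp_pair`: two unit vectors of species `s, t` (`…HalfPlanarKey`) at distance `≥ 1` with
azimuths `α ≤ β` satisfy `β − α ≥ δ(s,t)` and `α + 2π − β ≥ δ(s,t)` — from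
`⟪v,w⟫ = r_s r_t cos(β − α) + h_s h_t ≤ ½` and the KEY inequality, by strict antitonicity of `cos` on `[0, π]`.
-/

noncomputable section

namespace Summit.Ventures.Crystal3D.Theorems

open Finset Real
open Literature.Algebra.EuclideanLattices (inner_fin_three)
open scoped InnerProductSpace


/-! ## The frame `(e, m × e, m)`: coordinates, Parseval, azimuth -/

/-- The second frame coordinate: `det(m, e, v)` (`= ⟪v, m × e⟫`). -/
def hpY (m e v : EuclideanSpace ℝ (Fin 3)) : ℝ :=
  v 0 * (m 1 * e 2 - m 2 * e 1) + v 1 * (m 2 * e 0 - m 0 * e 2) + v 2 * (m 0 * e 1 - m 1 * e 0)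

/-- Polynomial Parseval identity for the frame `(e, m × e, m)`. -/
theorem hp_parseval_coord (m0 m1 m2 e0 e1 e2 u0 u1 u2 v0 v1 v2 : ℝ)
    (hm : m0 * m0 + m1 * m1 + m2 * m2 = 1) (he : e0 * e0 + e1 * e1 + e2 * e2 = 1)
    (hme : e0 * m0 + e1 * m1 + e2 * m2 = 0) :
    u0 * v0 + u1 * v1 + u2 * v2 =
      (u0 * e0 + u1 * e1 + u2 * e2) * (v0 * e0 + v1 * e1 + v2 * e2) +
        (u0 * (m1 * e2 - m2 * e1) + u1 * (m2 * e0 - m0 * e2) + u2 * (m0 * e1 - m1 * e0)) *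
          (v0 * (m1 * e2 - m2 * e1) + v1 * (m2 * e0 - m0 * e2) + v2 * (m0 * e1 - m1 * e0)) +
        (u0 * m0 + u1 * m1 + u2 * m2) * (v0 * m0 + v1 * m1 + v2 * m2) := by
  linear_combination
    (-(u0 * v0 + u1 * v1 + u2 * v2) - (e0 * e0 + e1 * e1 + e2 * e2 - 1) * (u0 * v0 + u1 * v1 + u2 * v2) +
        (u0 * e0 + u1 * e1 + u2 * e2) * (v0 * e0 + v1 * e1 + v2 * e2)) * hm +
      (-(u0 * v0 + u1 * v1 + u2 * v2) + (u0 * m0 + u1 * m1 + u2 * m2) * (v0 * m0 + v1 * m1 + v2 * m2)) * he +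
      ((e0 * m0 + e1 * m1 + e2 * m2) * (u0 * v0 + u1 * v1 + u2 * v2) -
          (e0 * v0 + e1 * v1 + e2 * v2) * (u0 * m0 + u1 * m1 + u2 * m2) -
          (m0 * v0 + m1 * v1 + m2 * v2) * (u0 * e0 + u1 * e1 + u2 * e2)) * hme

/-- **Parseval** in the frame `(e, m × e, m)`. -/
theorem hp_parseval {m e : EuclideanSpace ℝ (Fin 3)} (hm : ‖m‖ = 1) (he : ‖e‖ = 1) (hme : ⟪e, m⟫_ℝ = 0)
    (u v : EuclideanSpace ℝ (Fin 3)) :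
    ⟪u, v⟫_ℝ = ⟪u, e⟫_ℝ * ⟪v, e⟫_ℝ + hpY m e u * hpY m e v + ⟪u, m⟫_ℝ * ⟪v, m⟫_ℝ := by
  have hm' : m 0 * m 0 + m 1 * m 1 + m 2 * m 2 = 1 := by
    have h := real_inner_self_eq_norm_sq m
    rw [inner_fin_three, hm] at h; linarith
  have he' : e 0 * e 0 + e 1 * e 1 + e 2 * e 2 = 1 := by
    have h := real_inner_self_eq_norm_sq e
    rw [inner_fin_three, he] at h; linarith
  have hme' : e 0 * m 0 + e 1 * m 1 + e 2 * m 2 = 0 := by rw [inner_fin_three] at hme; exact hme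
  rw [inner_fin_three, inner_fin_three u e, inner_fin_three v e, inner_fin_three u m, inner_fin_three v m]
  unfold hpY
  exact hp_parseval_coord _ _ _ _ _ _ _ _ _ _ _ _ hm' he' hme'

/-- `det(m, e, e) = 0`. -/
theorem hpY_self (m e : EuclideanSpace ℝ (Fin 3)) : hpY m e e = 0 := by unfold hpY; ring

/-- The horizontal part of `v` as a complex number. -/
def hpZ (m e v : EuclideanSpace ℝ (Fin 3)) : ℂ := (⟪v, e⟫_ℝ : ℂ) + (hpY m e v : ℂ) * Complex.I

/-- The azimuth of `v` in `[0, 2π)`. -/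
def hpAz (m e v : EuclideanSpace ℝ (Fin 3)) : ℝ :=
  if (hpZ m e v).arg < 0 then (hpZ m e v).arg + 2 * π else (hpZ m e v).arg

/-- Azimuths are `≥ 0`. -/
theorem hpAz_nonneg (m e v : EuclideanSpace ℝ (Fin 3)) : 0 ≤ hpAz m e v := by
  unfold hpAz; split_ifs with h
  · have := Complex.neg_pi_lt_arg (hpZ m e v); linarith
  · linarith

/-- Azimuths are `< 2π`. -/
theorem hpAz_lt (m e v : EuclideanSpace ℝ (Fin 3)) : hpAz m e v < 2 * π := by
  unfold hpAz; split_ifs with h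
  · linarith
  · have := Complex.arg_le_pi (hpZ m e v); linarith [Real.pi_pos]

/-- `cos` of the azimuth is `cos` of the argument. -/
theorem cos_hpAz (m e v : EuclideanSpace ℝ (Fin 3)) : Real.cos (hpAz m e v) = Real.cos (hpZ m e v).arg := by
  unfold hpAz; split_ifs
  · rw [Real.cos_add_two_pi]
  · rfl

/-- `sin` of the azimuth is `sin` of the argument. -/
theorem sin_hpAz (m e v : EuclideanSpace ℝ (Fin 3)) : Real.sin (hpAz m e v) = Real.sin (hpZ m e v).arg := by
  unfold hpAz; split_ifs
  · rw [Real.sin_add_two_pi]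
  · rfl

/-- The modulus of the horizontal part. -/
theorem norm_hpZ (m e v : EuclideanSpace ℝ (Fin 3)) :
    ‖hpZ m e v‖ = Real.sqrt (⟪v, e⟫_ℝ ^ 2 + hpY m e v ^ 2) := by
  unfold hpZ; rw [Complex.norm_add_mul_I]

/-- `‖z_v‖² = 1 − ⟪v,m⟫²` for a unit vector `v`. -/
theorem norm_hpZ_sq {m e : EuclideanSpace ℝ (Fin 3)} (hm : ‖m‖ = 1) (he : ‖e‖ = 1) (hme : ⟪e, m⟫_ℝ = 0)
    {v : EuclideanSpace ℝ (Fin 3)} (hv : ‖v‖ = 1) :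
    ⟪v, e⟫_ℝ ^ 2 + hpY m e v ^ 2 = 1 - ⟪v, m⟫_ℝ ^ 2 := by
  have h := hp_parseval hm he hme v v
  rw [real_inner_self_eq_norm_sq, hv] at h
  nlinarith [h]

/-- Polar form of the horizontal part. -/
theorem hp_polar (m e v : EuclideanSpace ℝ (Fin 3)) (hz : hpZ m e v ≠ 0) :
    ⟪v, e⟫_ℝ = ‖hpZ m e v‖ * Real.cos (hpAz m e v) ∧ hpY m e v = ‖hpZ m e v‖ * Real.sin (hpAz m e v) := by
  have hn : ‖hpZ m e v‖ ≠ 0 := norm_ne_zero_iff.2 hz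
  rw [cos_hpAz, sin_hpAz, Complex.cos_arg hz, Complex.sin_arg]
  have hre : (hpZ m e v).re = ⟪v, e⟫_ℝ := by simp [hpZ]
  have him : (hpZ m e v).im = hpY m e v := by simp [hpZ]
  rw [hre, him]
  constructor <;> field_simp

/-- The azimuth of `e` itself is `0`. -/
theorem hpAz_self {m e : EuclideanSpace ℝ (Fin 3)} (he : ‖e‖ = 1) : hpAz m e e = 0 := by
  have hz : hpZ m e e = 1 := by
    unfold hpZ; rw [hpY_self, real_inner_self_eq_norm_sq, he]; simp
  unfold hpAz; rw [hz, Complex.arg_one]; simp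

/-- **The pair lemma.**  Two distinct unit vectors of species `s, t` at distance `≥ 1`, azimuths ordered:
both azimuth arcs are at least `δ(s,t)`. -/
theorem hp_pair {m e : EuclideanSpace ℝ (Fin 3)} (hm : ‖m‖ = 1) (he : ‖e‖ = 1) (hme : ⟪e, m⟫_ℝ = 0)
    {v w : EuclideanSpace ℝ (Fin 3)} (hv : ‖v‖ = 1) (hw : ‖w‖ = 1) {s t : ℕ} (hs : s < 5) (ht : t < 5)
    (hvs : ⟪v, m⟫_ℝ = hpH s) (hwt : ⟪w, m⟫_ℝ = hpH t) (hdist : 1 ≤ dist v w)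
    (hle : hpAz m e v ≤ hpAz m e w) :
    hpDelta s t ≤ hpAz m e w - hpAz m e v ∧ hpDelta s t ≤ hpAz m e v + 2 * π - hpAz m e w := by
  have hav := hpAz_nonneg m e v
  have haw := hpAz_lt m e w
  rcases hp_key s t hs ht with h0 | ⟨hkey, hδ0, hδπ⟩
  · rw [h0]; constructor <;> linarith
  -- the inner product bound
  have hinner : ⟪v, w⟫_ℝ ≤ 1 / 2 := by
    have h1 : ‖v - w‖ ^ 2 = ‖v‖ ^ 2 - 2 * ⟪v, w⟫_ℝ + ‖w‖ ^ 2 := norm_sub_sq_real v w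
    rw [hv, hw] at h1
    have h2 : (1 : ℝ) ≤ ‖v - w‖ := by rwa [dist_eq_norm] at hdist
    nlinarith [h1, h2]
  -- radii
  have hs5 : hpH s ^ 2 ≤ 2 / 3 := by
    interval_cases s <;> simp only [hpH_0, hpH_1, hpH_2, hpH_3, hpH_4] <;> nlinarith [hp_sqrt23_sq]
  have ht5 : hpH t ^ 2 ≤ 2 / 3 := by
    interval_cases t <;> simp only [hpH_0, hpH_1, hpH_2, hpH_3, hpH_4] <;> nlinarith [hp_sqrt23_sq]
  have hzv2 : ⟪v, e⟫_ℝ ^ 2 + hpY m e v ^ 2 = 1 - hpH s ^ 2 := by rw [norm_hpZ_sq hm he hme hv, hvs]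
  have hzw2 : ⟪w, e⟫_ℝ ^ 2 + hpY m e w ^ 2 = 1 - hpH t ^ 2 := by rw [norm_hpZ_sq hm he hme hw, hwt]
  have hnv : ‖hpZ m e v‖ = hpR s := by rw [norm_hpZ, hzv2]; rfl
  have hnw : ‖hpZ m e w‖ = hpR t := by rw [norm_hpZ, hzw2]; rfl
  have hRs : 0 < hpR s := by unfold hpR; exact Real.sqrt_pos.2 (by linarith)
  have hRt : 0 < hpR t := by unfold hpR; exact Real.sqrt_pos.2 (by linarith)
  have hzv : hpZ m e v ≠ 0 := by
    intro h0; rw [h0, norm_zero] at hnv; linarith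
  have hzw : hpZ m e w ≠ 0 := by
    intro h0; rw [h0, norm_zero] at hnw; linarith
  obtain ⟨hxv, hyv⟩ := hp_polar m e v hzv
  obtain ⟨hxw, hyw⟩ := hp_polar m e w hzw
  -- `⟪v,w⟫ = r_s r_t cos Δ + h_s h_t`
  set Δ := hpAz m e w - hpAz m e v with hΔ
  have hcosΔ : ⟪v, w⟫_ℝ = hpR s * hpR t * Real.cos Δ + hpH s * hpH t := by
    rw [hp_parseval hm he hme v w, hxv, hyv, hxw, hyw, hnv, hnw, hvs, hwt, hΔ, Real.cos_sub]; ring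
  have hmain : hpR s * hpR t * Real.cos Δ ≤ 1 / 2 - hpH s * hpH t := by linarith
  have hRR : 0 < hpR s * hpR t := mul_pos hRs hRt
  have hcos_le : Real.cos Δ ≤ Real.cos (hpDelta s t) := by
    by_contra hlt
    push Not at hlt
    have := mul_lt_mul_of_pos_left hlt hRR
    linarith
  have hΔ0 : 0 ≤ Δ := by rw [hΔ]; linarith
  have hΔ2 : Δ < 2 * π := by rw [hΔ]; linarith
  constructor
  · -- forward arc
    by_contra hlt
    push Not at hlt
    have : Real.cos (hpDelta s t) < Real.cos Δ :=
      Real.cos_lt_cos_of_nonneg_of_le_pi hΔ0 hδπ hlt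
    linarith
  · -- backward arc
    by_contra hlt
    push Not at hlt
    have h1 : 0 ≤ 2 * π - Δ := by linarith
    have h2 : 2 * π - Δ < hpDelta s t := by rw [hΔ]; linarith
    have : Real.cos (hpDelta s t) < Real.cos (2 * π - Δ) :=
      Real.cos_lt_cos_of_nonneg_of_le_pi h1 hδπ h2
    rw [Real.cos_two_pi_sub] at this
    linarith

end Summit.Ventures.Crystal3D.Theorems

end
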